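import Mathlib
import Summits.Ventures.PercRepro2.HMFRootEdgeChordTheorem

/-!
# (EXISTS-CHORD) holds whenever `a₃` has a fractional edge to a root (blind cell PercRepro2,
night-1 g18; NIGHT1-G18.md §2″)

The row of record of the crux line (mine-a §11, `Chord.ExistsChord`) asks, at every weight vector
with a fractional root edge, for ONE root edge `e` along which `Gloc = Gc / (D · Z)` lies above its
chord, `p_e · Gloc p[e ↦ 1] + (1 − p_e) · Gloc p[e ↦ 0] ≤ Gloc p`.  The root-edge chord theorem
(`RootEdge.rootTangent_nonneg`) proves exactly this chord, in its cleared form, along every edge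
`f = {a₃, a₁}`; at the sure end `Gloc p[f ↦ 1] = 0` (`D¹ = 0`, Lean's `x / 0 = 0`), so the cell's
chord is the weaker half of ours.  Hence:

* **`gloc_chord_root_edge`**: along `f = {a₃, a₁}`, `(1 − p f) · Gloc (p[f ↦ 0]) ≤ Gloc p`
  (the degenerate cases `D⁰ Z⁰ = 0` / `Z = 0` / `p f = 1` by the conventions);
* **`existsChord_of_root_edge`** / **`existsChord_of_root2_edge`**: (EXISTS-CHORD) at every `p`
  with a fractional edge from `a₃` to a root — the witness is that edge (it is a root edge: it
  touches the root cluster of `a₁` resp. `a₂`).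

Own code; standard axioms.
-/

namespace Summit.Ventures.PercRepro2

open UnionCluster CovForm

namespace RootEdge

section Gloc

variable {V : Type*} {E : Type*} [Fintype E] [DecidableEq E] [Fintype V] [DecidableEq V]
  {R : Type*} [Field R] [LinearOrder R] [IsStrictOrderedRing R]

variable (p : E → R) (ends : E → Sym2 V) (o : V) {a₁ a₂ a₃ : V} (b : V) {f : E}

/-- **The chord of `Gloc` along a root edge** (the cell's form, right end `0`):
`(1 − p f) · Gloc (p[f ↦ 0]) ≤ Gloc p` for `f = {a₃, a₁}`. -/
theorem gloc_chord_root_edge (hp : IsProbVec p) (hf : ends f = s(a₃, a₁)) :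
    (1 - p f) * Chord.Gloc (Function.update p f 0) ends o a₁ a₂ a₃ b ≤
      Chord.Gloc p ends o a₁ a₂ a₃ b := by
  have hp0 : IsProbVec (Function.update p f 0) := hp.update f le_rfl zero_le_one
  have hp1 : IsProbVec (Function.update p f 1) := hp.update f zero_le_one le_rfl
  have hq0 := hp.nonneg f
  have hq1 := hp.le_one f
  have hZ0 : 0 ≤ prob (Function.update p f 0) (avoidAll ends a₂ {a₁}) := prob_nonneg hp0 _
  have hZ1 : 0 ≤ prob (Function.update p f 1) (avoidAll ends a₂ {a₁}) := prob_nonneg hp1 _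
  have hZ : 0 ≤ prob p (avoidAll ends a₂ {a₁}) := prob_nonneg hp _
  have hD0 : 0 ≤ prob (Function.update p f 0) (PDEvent ends a₁ a₂ a₃) := prob_nonneg hp0 _
  -- `D = (1 − q) D⁰` along a root edge
  have hD : prob p (PDEvent ends a₁ a₂ a₃) =
      (1 - p f) * prob (Function.update p f 0) (PDEvent ends a₁ a₂ a₃) :=
    prob_eq_of_update_one_eq_zero p _ (by simpa using prob_PD_update_one p ends hf Set.univ)
  unfold Chord.Gloc
  -- the degenerate cases
  by_cases hden0 : prob (Function.update p f 0) (PDEvent ends a₁ a₂ a₃) *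
      prob (Function.update p f 0) (avoidAll ends a₂ {a₁}) = 0
  · rw [hden0, div_zero, mul_zero]
    -- then `D Z = 0` as well and `Gloc p = 0`
    have hZmono : prob p (avoidAll ends a₂ {a₁}) ≤
        prob (Function.update p f 0) (avoidAll ends a₂ {a₁}) :=
      EdmRow.prob_le_prob_update_zero_of_isLowerSet hp (EdmRow.isLowerSet_avoidAll ends a₁ a₂) f
    have hden : prob p (PDEvent ends a₁ a₂ a₃) * prob p (avoidAll ends a₂ {a₁}) = 0 := by
      rcases mul_eq_zero.1 hden0 with h | h
      · rw [hD, h]; ring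
      · exact mul_eq_zero_of_right _ (le_antisymm (h ▸ hZmono) hZ)
    rw [hden, div_zero]
  · have hden0' : 0 < prob (Function.update p f 0) (PDEvent ends a₁ a₂ a₃) *
        prob (Function.update p f 0) (avoidAll ends a₂ {a₁}) :=
      lt_of_le_of_ne (mul_nonneg hD0 hZ0) (Ne.symm hden0)
    have hD0pos : 0 < prob (Function.update p f 0) (PDEvent ends a₁ a₂ a₃) := by
      rcases hD0.lt_or_eq with h | h
      · exact h
      · exact absurd (by rw [← h]; ring) hden0
    have hZ0pos : 0 < prob (Function.update p f 0) (avoidAll ends a₂ {a₁}) := by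
      rcases hZ0.lt_or_eq with h | h
      · exact h
      · exact absurd (by rw [← h]; ring) hden0
    by_cases hq : p f = 1
    · -- the sure edge: the left side vanishes, the right side is `≥ 0` (`Gc = 0` there)
      rw [hq, sub_self, zero_mul]
      have hD1 : prob p (PDEvent ends a₁ a₂ a₃) = 0 := by rw [hD, hq]; ring
      rw [hD1, zero_mul, div_zero]
    · have hq1' : p f < 1 := lt_of_le_of_ne hq1 hq
      have h1q : 0 < 1 - p f := by linarith
      by_cases hZp : prob p (avoidAll ends a₂ {a₁}) = 0
      · -- `Z = 0`: the right side is `0 / 0 = 0`; the left side is `≤ 0` since `Z⁰ = 0` is forced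
        have hZmono : prob p (avoidAll ends a₂ {a₁}) ≤
            prob (Function.update p f 0) (avoidAll ends a₂ {a₁}) :=
          EdmRow.prob_le_prob_update_zero_of_isLowerSet hp (EdmRow.isLowerSet_avoidAll ends a₁ a₂) f
        -- `Z = (1 − q) Z⁰ + q Z¹ ≥ (1 − q) Z⁰ > 0`: contradiction
        have hpin := prob_eq_pin p (avoidAll ends a₂ {a₁}) f
        have : 0 < prob p (avoidAll ends a₂ {a₁}) := by
          rw [hpin]
          have := mul_nonneg hq0 hZ1
          have := mul_pos h1q hZ0pos
          linarith
        exact absurd hZp (ne_of_gt this)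
      · have hZpos : 0 < prob p (avoidAll ends a₂ {a₁}) := lt_of_le_of_ne hZ (Ne.symm hZp)
        have hden : 0 < prob p (PDEvent ends a₁ a₂ a₃) * prob p (avoidAll ends a₂ {a₁}) := by
          rw [hD]; positivity
        rw [mul_div_assoc', div_le_div_iff₀ hden0' hden]
        -- the cleared chord: `(1 − q) Gc⁰ · D Z ≤ Gc · D⁰ Z⁰`
        have hrows := rootTangent_nonneg p ends o (a₂ := a₂) b hp hf
        have hchord := rootNormChord_of_tangents p ends o (a₂ := a₂) b hp hf hrows.1 hrows.2
        have hΦ1 : 0 ≤ Phi (Function.update p f 1) ends o a₁ a₂ a₃ b f :=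
          Phi_nonneg_of_sure (Function.update p f 1) ends o a₁ a₂ a₃ b hp1 hf (by simp)
        have hΔ0 : 0 ≤ Xhat (Function.update p f 0) ends o a₁ a₂ a₃ b -
            Xexact (Function.update p f 0) ends o a₁ a₂ a₃ b := by
          linarith [Xexact_le_Xhat (Function.update p f 0) hp0 ends o a₁ a₂ a₃ b]
        have hΔ1 : 0 ≤ Xhat (Function.update p f 1) ends o a₁ a₂ a₃ b -
            Xexact (Function.update p f 1) ends o a₁ a₂ a₃ b := by
          linarith [Xexact_le_Xhat (Function.update p f 1) hp1 ends o a₁ a₂ a₃ b]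
        have hX := XhatPin.Xhat_eq_pin p ends o a₁ a₂ a₃ b (by rw [hf]; exact Sym2.mem_mk_left a₃ a₁)
        have hXe := Xexact_eq_pin p ends o (a₁ := a₁) (a₂ := a₂) (a₃ := a₃) b f
        have hG := OEdge.Gc_eq_HMFc_add p ends o a₁ a₂ a₃ b
        have hG0 := OEdge.Gc_eq_HMFc_add (Function.update p f 0) ends o a₁ a₂ a₃ b
        rw [HMFc_eq_factor p ends o b hf, hD, hX, hXe] at hG
        rw [hG, hG0]
        have hZZ : 0 ≤ prob (Function.update p f 0) (avoidAll ends a₂ {a₁}) *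
            prob (Function.update p f 1) (avoidAll ends a₂ {a₁}) := mul_nonneg hZ0 hZ1
        -- multiply the cleared chord by `(1 − q) D⁰ / Z¹` is not available when `Z¹ = 0`; instead use
        -- the tangent rows directly: `Z⁰ Z¹ Φ(p) ≥ (1 − q) Z Z¹ HMFc⁰ + q Z Z⁰ Φ¹`
        rcases hZ1.lt_or_eq with hZ1pos | hZ1zero
        · have key : (1 - p f) * prob p (avoidAll ends a₂ {a₁}) *
              (HMFc (Function.update p f 0) ends o a₁ a₂ a₃ b +
                2 * prob (Function.update p f 0) (avoidAll ends a₂ {a₁}) *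
                  prob (Function.update p f 0) (PDEvent ends a₁ a₂ a₃) *
                  (Xhat (Function.update p f 0) ends o a₁ a₂ a₃ b -
                    Xexact (Function.update p f 0) ends o a₁ a₂ a₃ b)) ≤
              prob (Function.update p f 0) (avoidAll ends a₂ {a₁}) *
                (Phi p ends o a₁ a₂ a₃ b f +
                  2 * prob p (avoidAll ends a₂ {a₁}) *
                    prob (Function.update p f 0) (PDEvent ends a₁ a₂ a₃) *
                    ((p f * Xhat (Function.update p f 1) ends o a₁ a₂ a₃ b +
                        (1 - p f) * Xhat (Function.update p f 0) ends o a₁ a₂ a₃ b) -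
                      (p f * Xexact (Function.update p f 1) ends o a₁ a₂ a₃ b +
                        (1 - p f) * Xexact (Function.update p f 0) ends o a₁ a₂ a₃ b))) := by
            have hC : 0 ≤ p f * prob p (avoidAll ends a₂ {a₁}) *
                prob (Function.update p f 0) (avoidAll ends a₂ {a₁}) *
                (Phi (Function.update p f 1) ends o a₁ a₂ a₃ b f +
                  2 * prob (Function.update p f 1) (avoidAll ends a₂ {a₁}) *
                    prob (Function.update p f 0) (PDEvent ends a₁ a₂ a₃) *
                    (Xhat (Function.update p f 1) ends o a₁ a₂ a₃ b -
                      Xexact (Function.update p f 1) ends o a₁ a₂ a₃ b)) :=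
              mul_nonneg (mul_nonneg (mul_nonneg hq0 hZ) hZ0)
                (add_nonneg hΦ1 (mul_nonneg (mul_nonneg (mul_nonneg (by norm_num) hZ1) hD0) hΔ1))
            -- divide the `Z¹`-multiplied inequality by `Z¹ > 0`
            have hmul : prob (Function.update p f 1) (avoidAll ends a₂ {a₁}) *
                ((1 - p f) * prob p (avoidAll ends a₂ {a₁}) *
                  (HMFc (Function.update p f 0) ends o a₁ a₂ a₃ b +
                    2 * prob (Function.update p f 0) (avoidAll ends a₂ {a₁}) *
                      prob (Function.update p f 0) (PDEvent ends a₁ a₂ a₃) *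
                      (Xhat (Function.update p f 0) ends o a₁ a₂ a₃ b -
                        Xexact (Function.update p f 0) ends o a₁ a₂ a₃ b))) ≤
                prob (Function.update p f 1) (avoidAll ends a₂ {a₁}) *
                (prob (Function.update p f 0) (avoidAll ends a₂ {a₁}) *
                  (Phi p ends o a₁ a₂ a₃ b f +
                    2 * prob p (avoidAll ends a₂ {a₁}) *
                      prob (Function.update p f 0) (PDEvent ends a₁ a₂ a₃) *
                      ((p f * Xhat (Function.update p f 1) ends o a₁ a₂ a₃ b +
                          (1 - p f) * Xhat (Function.update p f 0) ends o a₁ a₂ a₃ b) -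
                        (p f * Xexact (Function.update p f 1) ends o a₁ a₂ a₃ b +
                          (1 - p f) * Xexact (Function.update p f 0) ends o a₁ a₂ a₃ b)))) := by
              nlinarith [hchord, hC]
            exact le_of_mul_le_mul_left hmul hZ1pos
          -- now multiply out `D = (1 − q) D⁰` on both sides
          have hD0' : 0 ≤ (1 - p f) * prob (Function.update p f 0) (PDEvent ends a₁ a₂ a₃) :=
            (mul_pos h1q hD0pos).le
          rw [hD]
          have h := mul_le_mul_of_nonneg_left key hD0'
          linear_combination h
        · -- `Z¹ = 0`: then `D⁰ ≤ Z¹ = 0`, against `D⁰ > 0`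
          have hcoup := prob_PD_update_zero_le_prob_Q_update_one p ends (a₂ := a₂) hp hf
          rw [← hZ1zero] at hcoup
          exact absurd (le_antisymm hcoup hD0) (ne_of_gt hD0pos)

end Gloc

section Exists

variable {V : Type*} {E : Type*} [Fintype E] [DecidableEq E] [Fintype V] [DecidableEq V]
  {R : Type*} [Field R] [LinearOrder R] [IsStrictOrderedRing R]

variable (p : E → R) (ends : E → Sym2 V) (o : V) {a₁ a₂ a₃ : V} (b : V) {f : E}

omit [DecidableEq E] [Fintype V] [DecidableEq V] [IsStrictOrderedRing R] in
/-- A fractional edge `{a₃, a₁}` is a root edge in the sense of `Chord.rootEdges`. -/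
lemma mem_rootEdges_of_root_edge (hf : ends f = s(a₃, a₁)) (hfrac : p f ≠ 0 ∧ p f ≠ 1) :
    f ∈ Chord.rootEdges p ends a₁ a₂ := by
  classical
  simp only [Chord.rootEdges, Finset.mem_filter, Chord.mem_frac, mem_touches, Chord.rootSet,
    Set.mem_union]
  exact ⟨hfrac, a₁, Or.inl (mem_cluster_self ends _ a₁), a₃, by rw [hf, Sym2.eq_swap]⟩

/-- **(EXISTS-CHORD) at every weight vector with a fractional edge from `a₃` to `a₁`**: that edge
is a root edge along which `Gloc` lies above its chord. -/
theorem existsChord_of_root_edge (hp : IsProbVec p) (hf : ends f = s(a₃, a₁))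
    (hfrac : p f ≠ 0 ∧ p f ≠ 1) : Chord.ExistsChord p ends o a₁ a₂ a₃ b := by
  intro _
  refine ⟨f, mem_rootEdges_of_root_edge p ends hf hfrac, ?_⟩
  -- the sure end: `D¹ = 0` kills `Gloc`
  have hD1 : prob (Function.update p f 1) (PDEvent ends a₁ a₂ a₃) = 0 := by
    simpa using prob_PD_update_one p ends hf Set.univ
  have h1 : Chord.Gloc (Function.update p f 1) ends o a₁ a₂ a₃ b = 0 := by
    unfold Chord.Gloc
    rw [hD1, zero_mul, div_zero]
  rw [h1, mul_zero, zero_add]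
  exact gloc_chord_root_edge p ends o b hp hf

/-- **(EXISTS-CHORD) at every weight vector with a fractional edge from `a₃` to `a₂`** (by the root
symmetry of `Gc`, `PD`, `Q` and of `Chord.rootSet`). -/
theorem existsChord_of_root2_edge (hp : IsProbVec p) (hf : ends f = s(a₃, a₂))
    (hfrac : p f ≠ 0 ∧ p f ≠ 1) : Chord.ExistsChord p ends o a₁ a₂ a₃ b := by
  have h := existsChord_of_root_edge p ends o (a₁ := a₂) (a₂ := a₁) b hp hf hfrac
  -- transport along the root swap
  have hroot : Chord.rootEdges p ends a₂ a₁ = Chord.rootEdges p ends a₁ a₂ := by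
    classical
    ext e
    simp only [Chord.rootEdges, Chord.rootSet, Finset.mem_filter, mem_touches, Set.mem_union]
    constructor
    · rintro ⟨hfr, x, hx, y, hy⟩; exact ⟨hfr, x, hx.symm, y, hy⟩
    · rintro ⟨hfr, x, hx, y, hy⟩; exact ⟨hfr, x, hx.symm, y, hy⟩
  have hgloc : ∀ q : E → R, Chord.Gloc q ends o a₂ a₁ a₃ b = Chord.Gloc q ends o a₁ a₂ a₃ b := by
    intro q
    unfold Chord.Gloc
    rw [CovForm.Gc_swap, PDEvent_root_swap, avoidAll_root_swap]
  intro hne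
  rw [← hroot] at hne
  obtain ⟨e, he, hle⟩ := h hne
  refine ⟨e, hroot ▸ he, ?_⟩
  rw [hgloc, hgloc, hgloc] at hle
  exact hle

end Exists

end RootEdge

end Summit.Ventures.PercRepro2
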